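import Summits.ResolutionOfSingularities.ResolutionOfSingularities.Theorems.PurelyInseparableDim4MilnorFinite
import Summits.ResolutionOfSingularities.ResolutionOfSingularities.Theorems.PurelyInseparableDim4IsolationCert
import Literature.RingTheory.MvPowerSeries.FiniteColength
import Literature.RingTheory.MvPowerSeries.MaximalIdealPow
import HarnessLib

/-!
# [OURS · res-dim4-pi F4-I dictionary] A FINITE formal Milnor algebra forces an ISOLATED `q`-fold point
  (the converse bridge `Isol ⇒ IsIsolated`, every `q ≥ 2`)

Cell `res-dim4-pi` (D-0157 DOOR 2), frame v4 TIER 1 (I); seat `res-dim4-p-5`. Def-free companion of p-12's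
`PurelyInseparableDim4MilnorFinite` (`milnorFinite_of_isIsolated_two`: the direction `IsIsolated 2 ⇒ Isol` used
by the WildCones bridge). Here the OTHER direction, for EVERY `q ≥ 2`: if the formal Milnor algebra
`K⟦x⟧ ⧸ ⟨∂₁↑F, …, ∂₄↑F⟩` is finite over `K` and the origin is a `q`-fold point (`J_q⁺(F) ≤ 𝔪₀`), then the
origin is an ISOLATED `q`-fold point of the frame (`IsIsolated q F`). Reason: `𝔪̂ᴹ ≤ ⟨∂ᵢ↑F⟩` for some `M`
(tree `Jets.exists_maximalIdeal_pow_le_of_finite_quotient`), truncating the power-series coefficients at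
degree `M + 1` turns this into p-3's polynomial certificate `𝔪₀ᴹ ≤ ⟨∂ᵢF⟩ + 𝔪₀ᴹ⁺¹ ≤ J_q⁺(F) + 𝔪₀ᴹ⁺¹`
(the first-order Hasse derivatives ARE the partials, `IsolationCert.hasseDeriv_single_one`), and
`IsolationCert.isIsolated_of_pow_le_sup_pow_succ` concludes.

Consequences: `isIsolated_two_iff_milnorFinite` (with p-12's direction: at `q = 2` the two notions
coincide on double points) and, for `p ≥ 3`, the precise inclusion behind the desk's «F4-I(p,p) PARTIAL»
reading of the in-house route `WildCones` (WORD #30 (b)): its `Isol` regime (finite Milnor algebra of FIRST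
derivatives) sits INSIDE the frame's isolated regime — every Milnor-finite `q`-fold state is `IsIsolated q`.

[OURS · counted 0 · AI work weaker than expert review] Bookkeeping between two typings of this tree; nothing
here proves `NoIsolatedTrap` or resolution of singularities in dimension ≥ 4 / characteristic `p`.
bears_on: LADDER-RESOLUTION:D157-DOOR2 (res-dim4-pi · F4-I dictionary). Supports stmt-ResolutionOfSingularities-16155
(helper).
-/

set_option linter.dupNamespace false -- mandated namespace of this single-conjunct summit

noncomputable section

namespace Summit.ResolutionOfSingularities.ResolutionOfSingularities.Theorems.PIDim4

namespace IsolatedBand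

open MvPolynomial Finset IsLocalRing
open Literature.AlgebraicGeometry.Resolution
open Literature.RingTheory.MvPowerSeries

variable {K : Type} [Field K]

/-! ## §1 The partials generate a sub-ideal of `J_q⁺(F)` -/

/-- For `q ≥ 2`, `⟨∂₁F, …, ∂₄F⟩ ≤ J_q⁺(F)` (the first partials are the Hasse derivatives of order `1 < q`).
[cite: Giraud1975, §1 (Hasse–Schmidt derivations)] [folklore] -/
theorem span_pderiv_le_singLocusIdeal {q : ℕ} (hq : 2 ≤ q) (F : MvPolynomial (Fin 4) K) :
    Ideal.span (Set.range fun i : Fin 4 => pderiv i F) ≤ singLocusIdeal q F := by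
  rw [Ideal.span_le]
  rintro _ ⟨i, rfl⟩
  refine Ideal.subset_span ⟨Finsupp.single i 1, ?_, ?_, ?_⟩
  · rw [Finsupp.degree_single]; exact Nat.one_pos
  · rw [Finsupp.degree_single]; omega
  · exact (IsolationCert.hasseDeriv_single_one i F).symm

/-! ## §2 Polynomials in a power of the formal maximal ideal -/

/-- A polynomial lies in `𝔪̂ⁿ ⊂ K⟦x⟧` iff it lies in `𝔪₀ⁿ ⊂ K[x]` (both say: no monomial of degree `< n`).
[folklore] -/
theorem coe_mem_maximalIdeal_pow_iff (n : ℕ) (G : MvPolynomial (Fin 4) K) :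
    (G : MvPowerSeries (Fin 4) K) ∈ maximalIdeal (MvPowerSeries (Fin 4) K) ^ n ↔
      G ∈ originIdeal K ^ n := by
  rw [Jets.mem_maximalIdeal_pow_iff, IsolationCert.mem_originIdeal_pow_iff]
  simp only [MvPolynomial.coeff_coe]

/-! ## §3 From `𝔪̂ᴹ ≤ ⟨∂ᵢ ↑F⟩` to the polynomial certificate -/

/-- **Truncation turns a formal inclusion into a certificate.** If `𝔪̂ᴹ ≤ ⟨∂₁↑F, …, ∂₄↑F⟩` in `K⟦x⟧`, then
every degree-`M` monomial lies in `⟨∂ᵢF⟩ + 𝔪₀ᴹ⁺¹` in `K[x]`: write `x^γ = Σ gᵢ ∂ᵢF` with `gᵢ ∈ K⟦x⟧` and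
replace each `gᵢ` by its jet of order `M` (`truncTotal (M+1) gᵢ`); the error is `Σ (gᵢ − jet) ∂ᵢF ∈ 𝔪̂ᴹ⁺¹`.
[folklore] -/
theorem monomial_mem_span_pderiv_sup_of_maximalIdeal_pow_le {F : MvPolynomial (Fin 4) K} {M : ℕ}
    (h : maximalIdeal (MvPowerSeries (Fin 4) K) ^ M ≤
      Ideal.span (Set.range fun i : Fin 4 => MvPowerSeries.pderiv i (F : MvPowerSeries (Fin 4) K)))
    {γ : Fin 4 →₀ ℕ} (hγ : γ.degree = M) :
    monomial γ (1 : K) ∈ Ideal.span (Set.range fun i : Fin 4 => pderiv i F) ⊔ originIdeal K ^ (M + 1) := by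
  classical
  -- `↑x^γ ∈ 𝔪̂ᴹ ≤ ⟨∂ᵢ ↑F⟩`
  have hmem : ((monomial γ (1 : K) : MvPolynomial (Fin 4) K) : MvPowerSeries (Fin 4) K) ∈
      Ideal.span (Set.range fun i : Fin 4 => MvPowerSeries.pderiv i (F : MvPowerSeries (Fin 4) K)) := by
    refine h ?_
    rw [MvPolynomial.coe_monomial]
    exact Jets.monomial_mem_maximalIdeal_pow hγ.ge 1
  obtain ⟨g, hg⟩ := Ideal.mem_span_range_iff_exists_fun.mp hmem
  -- the polynomial part
  set G : MvPolynomial (Fin 4) K := ∑ i, MvPowerSeries.truncTotal (M + 1) (g i) * pderiv i F with hG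
  have hGmem : G ∈ Ideal.span (Set.range fun i : Fin 4 => pderiv i F) :=
    Ideal.sum_mem _ fun i _ => Ideal.mul_mem_left _ _ (Ideal.subset_span ⟨i, rfl⟩)
  refine IsolationCert.monomial_mem_sup_of_sub_mem hGmem ?_
  -- the remainder lies in `𝔪̂ᴹ⁺¹`, hence in `𝔪₀ᴹ⁺¹`
  rw [← coe_mem_maximalIdeal_pow_iff]
  have hcoe : (((monomial γ (1 : K) : MvPolynomial (Fin 4) K) - G : MvPolynomial (Fin 4) K) :
      MvPowerSeries (Fin 4) K) =
      ∑ i, (g i - (MvPowerSeries.truncTotal (M + 1) (g i) : MvPolynomial (Fin 4) K)) *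
        MvPowerSeries.pderiv i (F : MvPowerSeries (Fin 4) K) := by
    have hsub : (((monomial γ (1 : K) : MvPolynomial (Fin 4) K) - G : MvPolynomial (Fin 4) K) :
        MvPowerSeries (Fin 4) K) =
        ((monomial γ (1 : K) : MvPolynomial (Fin 4) K) : MvPowerSeries (Fin 4) K) -
          (G : MvPowerSeries (Fin 4) K) :=
      map_sub (MvPolynomial.coeToMvPowerSeries.ringHom (σ := Fin 4) (R := K)) _ _
    have hGcoe : (G : MvPowerSeries (Fin 4) K) =
        ∑ i, ((MvPowerSeries.truncTotal (M + 1) (g i) : MvPolynomial (Fin 4) K) :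
          MvPowerSeries (Fin 4) K) * MvPowerSeries.pderiv i (F : MvPowerSeries (Fin 4) K) := by
      rw [hG]
      have := map_sum (MvPolynomial.coeToMvPowerSeries.ringHom (σ := Fin 4) (R := K))
        (fun i : Fin 4 => MvPowerSeries.truncTotal (M + 1) (g i) * pderiv i F) Finset.univ
      rw [MvPolynomial.coeToMvPowerSeries.ringHom_apply] at this
      rw [this]
      refine Finset.sum_congr rfl fun i _ => ?_
      rw [MvPolynomial.coeToMvPowerSeries.ringHom_apply, MvPolynomial.coe_mul, MvPowerSeries.pderiv_coe]
    rw [hsub, ← hg, hGcoe, ← Finset.sum_sub_distrib]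
    refine Finset.sum_congr rfl fun i _ => ?_
    rw [sub_mul]
  rw [hcoe]
  refine Ideal.sum_mem _ fun i _ => Ideal.mul_mem_right _ _ ?_
  exact Jets.sub_coe_truncTotal_mem_maximalIdeal_pow (M + 1) (g i)

/-- Hence **`𝔪̂ᴹ ≤ ⟨∂ᵢ ↑F⟩` gives the polynomial certificate `𝔪₀ᴹ ≤ J_q⁺(F) + 𝔪₀ᴹ⁺¹`** for every `q ≥ 2`.
[folklore] -/
theorem certificate_of_maximalIdeal_pow_le_span_pderiv {q : ℕ} (hq : 2 ≤ q) {F : MvPolynomial (Fin 4) K}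
    {M : ℕ} (h : maximalIdeal (MvPowerSeries (Fin 4) K) ^ M ≤
      Ideal.span (Set.range fun i : Fin 4 => MvPowerSeries.pderiv i (F : MvPowerSeries (Fin 4) K))) :
    originIdeal K ^ M ≤ singLocusIdeal q F ⊔ originIdeal K ^ (M + 1) := by
  refine IsolationCert.pow_le_sup_pow_succ_of_forall_monomial fun γ hγ => ?_
  exact sup_le_sup_right (span_pderiv_le_singLocusIdeal hq F) _
    (monomial_mem_span_pderiv_sup_of_maximalIdeal_pow_le h hγ)

/-! ## §4 Milnor-finite ⇒ isolated -/

/-- **A FINITE formal Milnor algebra forces an ISOLATED `q`-fold point** (`q ≥ 2`): if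
`K⟦x⟧ ⧸ ⟨∂₁↑F, …, ∂₄↑F⟩` is finite over `K` and `J_q⁺(F) ≤ 𝔪₀` (the origin is `q`-fold), then
`IsIsolated q F`. The in-house route `WildCones`' hypothesis `Isol` thus lands INSIDE the frame's isolated
regime for every `p`. [folklore] -/
theorem isIsolated_of_milnorFinite {q : ℕ} (hq : 2 ≤ q) {F : MvPolynomial (Fin 4) K}
    (hJ : singLocusIdeal q F ≤ originIdeal K)
    (hfin : Module.Finite K (MvPowerSeries (Fin 4) K ⧸
      Ideal.span (Set.range fun i : Fin 4 => MvPowerSeries.pderiv i (F : MvPowerSeries (Fin 4) K)))) :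
    IsIsolated q F := by
  haveI := hfin
  obtain ⟨M, hM⟩ := Jets.exists_maximalIdeal_pow_le_of_finite_quotient
    (Ideal.span (Set.range fun i : Fin 4 => MvPowerSeries.pderiv i (F : MvPowerSeries (Fin 4) K)))
  exact IsolationCert.isIsolated_of_pow_le_sup_pow_succ hJ
    (certificate_of_maximalIdeal_pow_le_span_pderiv hq hM)

/-- **At `q = 2` the two notions coincide on double points**: `IsIsolated 2 F ↔ J₂⁺(F) ≤ 𝔪₀ ∧
K⟦x⟧ ⧸ ⟨∂ᵢ↑F⟩` finite (⇒ is p-12's `WildConesBridge.milnorFinite_of_isIsolated_two`). [folklore] -/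
theorem isIsolated_two_iff_milnorFinite {F : MvPolynomial (Fin 4) K} :
    IsIsolated 2 F ↔ singLocusIdeal 2 F ≤ originIdeal K ∧
      Module.Finite K (MvPowerSeries (Fin 4) K ⧸
        Ideal.span (Set.range fun i : Fin 4 => MvPowerSeries.pderiv i (F : MvPowerSeries (Fin 4) K))) :=
  ⟨fun h => ⟨h.1, WildConesBridge.milnorFinite_of_isIsolated_two h⟩,
    fun h => isIsolated_of_milnorFinite (le_refl 2) h.1 h.2⟩

end IsolatedBand

end Summit.ResolutionOfSingularities.ResolutionOfSingularities.Theorems.PIDim4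

end
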